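import Summits.NavierStokesRegularity.NavierStokesRegularity.Theorems.ScenarioCensusRowF1ax
import Summits.NavierStokesRegularity.NavierStokesRegularity.Theorems.ScenarioCensusRowA7h
import Summits.NavierStokesRegularity.NavierStokesRegularity.Theorems.DssFarFieldSlavingBlowupTypeIDssProfileSimilarityEnstrophyBeltramiLiouville
import Summits.NavierStokesRegularity.NavierStokesRegularity.Theorems.SqueezeCycleSingularZoomWindow
import Summits.NavierStokesRegularity.NavierStokesRegularity.Theorems.ClockStretchingLawClockCeilingZoomDerivLimit
import Summits.NavierStokesRegularity.NavierStokesRegularity.Theorems.PoloidalWindowDoorPoloidalWindowRigidityVorticityTranslate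
import Summits.NavierStokesRegularity.NavierStokesRegularity.Theorems.HalfSpaceWindowDoorCirculationCarryingRigidityWholeSpaceMaxPrinciple
import Literature.Analysis.FluidPDE.TypeIAncientMild
import Literature.Analysis.FluidPDE.WholeSpaceIBP
import Literature.Analysis.FluidPDE.ClassicalSolutionCalculus
import Literature.Analysis.FluidPDE.VorticityEquation
import Literature.Analysis.FluidPDE.TypeIAncientMildClassical
import Summits.NavierStokesRegularity.NavierStokesRegularity.Theorems.DssFarFieldSlavingBlowupTypeIDssProfileSimilarityEnstrophyCrossFlowNoDecayOne
import Summits.NavierStokesRegularity.NavierStokesRegularity.Theorems.DssFarFieldSlavingBlowupTypeIDssProfileSimilarityEnstrophyTimeOnlyThreshold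
import HarnessLib
import Summits.NavierStokesRegularity.NavierStokesRegularity.Theorems.ScenarioCensusRowF1SocketReadout

/-!
# Census row F1, family «LIOUVILLE SOCKET» — the SHARP member F1xf♯ (floor DSX) — LINE 28 «sharp-top» port, part 1/4: §8♯ THE CRITICAL-LEVEL TRANSFER (`critLevel`,
# `eventually_fast_crit`, `integral_transfer₆τ_crit`).  §1–§5, §8, §9–§11 of the line are LINE 27 «liouville-socket» VERBATIM and are taken BY NAME from its landed port
# (`open …ScenarioCensus.LiouvilleSocket`; not re-declared)

Re-homed for the scenario census (typer seat ns-census-typer-1 g9; the cell F1xf♯ and the floor DSX are MEMBERS OF RECORD «DECIDED IN KERNEL IN FILES» of row F1 since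
census v1.81 (critic idea-crit-3 g8 PASS 04:49Z — no price; ref ns-census-ref g11 PRE-CHECK ✓ §16.4 item 49; lead-presearch label); this port makes them TREE-decided):
VERBATIM PORT of the NEW sections (§8♯, §12, §13) of ns-idea-3 LINE 28 «sharp-top», `pub/ideators/ns-idea-3/lines/sharp-top/line-sharp-top.lean` sha16 3f3b055f6f2a207c
(2536 l., lean check rc 0, 0 sorry; its §1–§5 / §8 / §9–§11 = LINE 27 «liouville-socket» 01bcb6dd501a8321 byte-identical — 106/106 declarations, taken BY NAME from
`ScenarioCensusRowF1Socket*`), split for the 400-line rule into `ScenarioCensusRowF1SharpTop` (§8♯) → `…SharpTopDom` (§12) → `…SharpTopCrit` (§12 end: the critical level as a speed threshold) → `…SharpTopRow` (§13 + census KEYS); each part imports only the parts it uses.  Lean text VERBATIM in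
namespace `…Theorems.ScenarioCensus.SharpTop` (the line's `…Cruxes.ScenarioCensusRowF1.SharpTopLine` re-homed) with `open …ScenarioCensus.LiouvilleSocket`; port edits:
the bracket lines `section IntegralTransferCrit` / `end …` dropped (no `variable`s), `@[conjecture]` on the residual `SharpSlack` (≡ `ScenarioCensus.Row_F1`, OPEN),
one-line docstrings added where missing (gate lint); `norm_cross_le` is the Literature lemma `norm_cross_le_mul_norm` taken BY NAME and the display `rowF1xf_holds'` (a second proof term of LINE 27's row) is not re-declared.  Statements untouched.

No census VALUE is moved here (row F1 stays OPEN-WITH-LINE; the member becomes TREE-decided by name); NS regularity is NOT proved; `Row_F1` is untouched (zero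
movement, `sharpSlack_iff_rowF1`); no summit statement is proved by this file. Lemmas that restate already-landed tree declarations are taken BY NAME (gate lint `dedup.landed`): `fderiv_smul_stPull_apply` = `InviscidTop.fderiv_smul_stPull_apply`, `fderiv_smul_stPull` = `InviscidTop.fderiv_smul_stPull`, `fderiv_fderiv_smul_stPull` = `InviscidTop.fderiv_fderiv_smul_stPull`, `tendsto_clm_of_tendsto_apply` = `InviscidTop.tendsto_clm_of_tendsto_apply`, `tendsto_fderiv_fderiv_apply_of_bound` = `InviscidTop.tendsto_fderiv_fderiv_apply_of_bound`, `tendsto_fderiv_fderiv_of_bound` = `InviscidTop.tendsto_fderiv_fderiv_of_bound`, `tendsto_fderiv_fderiv_of_typeI_seq_Ioo` = `InviscidTop.tendsto_fderiv_fderiv_of_typeI_seq_Ioo`, `fderiv3_smul_stPull` = `FrozenTop.fderiv3_smul_stPull`, `tendsto_fderiv3_of_typeI_seq_Ioo` = `FrozenTop.tendsto_fderiv3_of_typeI_seq_Ioo`, `tendsto_physicalTime` = `ColumnarTop.tendsto_physicalTime`, `eventually_fast` = `ColumnarTop.eventually_fast`, `sqrt_timeLag` = `StretchedTop.sqrt_timeLag`,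 `forall_of_forall_ne_zero` = `StretchedTop.forall_of_forall_ne_zero`, `radius_eq` = `FrozenTop.radius_eq`, `jointCond_everywhere₆` = `FrozenTop.jointCond_everywhere₄`, `continuousOn_quad` = `IntegratedStretch.continuousOn_quad`, `sqrt_nu_timeLag` = `IntegratedStretch.sqrt_nu_timeLag`, `sing_of_not_bounded` = `InviscidTop.sing_of_not_bounded`, `exists_singularZoom_package₃` = `FrozenTop.exists_singularZoom_package₃`, `lapD_eq_zero_of_eq_zero` = `FrozenTop.lapD_eq_zero_of_eq_zero`, `measurableSet_top` = `IntegratedStretch.measurableSet_top`, `norm_cross_le` = `norm_cross_le_mul_norm`.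
-/

-- the summit and its single problem share the name `NavierStokesRegularity` (D-0017 nested layout)
set_option linter.dupNamespace false

noncomputable section

open MeasureTheory Set Function Filter TopologicalSpace Metric
open scoped Topology NNReal ENNReal InnerProductSpace RealInnerProductSpace Laplacian

namespace Summit.NavierStokesRegularity.NavierStokesRegularity.Theorems.ScenarioCensus.SharpTop

open Literature.Analysis Literature.Analysis.FluidPDE
open Summit.NavierStokesRegularity.NavierStokesRegularity.Theorems
open Summit.NavierStokesRegularity.NavierStokesRegularity.Theorems.ScenarioCensus.LiouvilleSocket

/-! ## §8♯ THE CRITICAL-LEVEL TRANSFER (NEW in LINE 28): the level is the CRITICAL one,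
`Λ♯(t) = √(κ′ν/(T − t))` — a fixed fraction `√κ′` of the self-similar speed — which does NOT disappear in the
zoom: the rescaled fast set converges to the OPEN set `{(s, y) : κ′ < (−s)‖W(s, y)‖²}` of the limit, and the
transfer concludes `Rd ≤ 0` exactly there (Fatou + lower semicontinuity of the indicator of an open jet
condition).  The slow part `{(−s)‖W‖² ≤ κ′}` is handled afterwards by SPEED DOMINATION of the read-out (§12). -/

/-- The CRITICAL level `Λ♯(t) = √(κ′ · ν (T − t)⁻¹)` (a fixed fraction of the self-similar speed). -/
def critLevel (T ν κ' : ℝ) (t : ℝ) : ℝ := Real.sqrt (κ' * (ν * (T - t)⁻¹))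

/-- The critical level is measurable. -/
theorem measurable_critLevel (T ν κ' : ℝ) : Measurable (critLevel T ν κ') := by
  unfold critLevel
  exact Real.continuous_sqrt.measurable.comp
    (measurable_const.mul (measurable_const.mul ((measurable_const.sub measurable_id).inv)))

/-- The critical level is non-negative. -/
theorem critLevel_nonneg (T ν κ' t : ℝ) : 0 ≤ critLevel T ν κ' t := Real.sqrt_nonneg _

/-- The square of the critical level. -/
theorem critLevel_sq {T ν κ' t : ℝ} (hκ' : 0 ≤ κ') (hν : 0 ≤ ν) (ht : t < T) :
    critLevel T ν κ' t ^ 2 = κ' * (ν * (T - t)⁻¹) := by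
  unfold critLevel
  rw [Real.sq_sqrt (mul_nonneg hκ' (mul_nonneg hν (inv_nonneg.2 (sub_pos.2 ht).le)))]

/-- `|v|² ≤ κ′ν/(T − t)` iff `|v| ≤ Λ♯(t)` (squares of non-negative reals). -/
theorem norm_le_critLevel_iff {T ν κ' t : ℝ} (hκ' : 0 ≤ κ') (hν : 0 ≤ ν) (ht : t < T) (v : E3) :
    ‖v‖ ≤ critLevel T ν κ' t ↔ ‖v‖ ^ 2 ≤ κ' * (ν * (T - t)⁻¹) := by
  rw [← critLevel_sq hκ' hν ht, pow_le_pow_iff_left₀ (norm_nonneg _) (critLevel_nonneg _ _ _ _) two_ne_zero]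

/-- At a limit point with `κ′ < (−t)‖W(t, y)‖²` the rescaled physical point is EVENTUALLY above the critical level
(`α√ν = √β` makes `Λ♯(t_j) · c_jα ≡ √(κ′/(−t))` constant along the sequence). -/
theorem eventually_fast_crit {T ν : ℝ} {u : ℝ → E3 → E3} {x₀ : E3} {α β R : ℝ} {c : ℕ → ℝ} {W : ℝ → E3 → E3}
    (hν : 0 < ν) (hα : 0 < α) (hβ : 0 < β) (hαν : α * Real.sqrt ν = Real.sqrt β) (hcpos : ∀ j, 0 < c j)
    (hpt : ∀ t < 0, ∀ y : E3,
      Tendsto (fun j => (c j * α) • u (T + c j ^ 2 * β * t) (x₀ + (c j * R) • y)) atTop (𝓝 (W t y)))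
    {κ' : ℝ} (hκ' : 0 ≤ κ') {t : ℝ} (ht : t < 0) {y : E3} (hfast : κ' < -t * ‖W t y‖ ^ 2) :
    ∀ᶠ j in atTop, critLevel T ν κ' (T + c j ^ 2 * β * t) < ‖u (T + c j ^ 2 * β * t) (x₀ + (c j * R) • y)‖ := by
  have ht' : 0 < -t := neg_pos.2 ht
  have hαν2 : α ^ 2 * ν = β := by
    have h := congrArg (fun r : ℝ => r ^ 2) hαν
    simpa only [mul_pow, Real.sq_sqrt hν.le, Real.sq_sqrt hβ.le] using h
  have hWfast : κ' * (-t)⁻¹ < ‖W t y‖ ^ 2 := by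
    rw [← div_eq_mul_inv, div_lt_iff₀ ht']
    linarith [mul_comm (-t) (‖W t y‖ ^ 2)]
  have hlim2 : Tendsto (fun j => ‖(c j * α) • u (T + c j ^ 2 * β * t) (x₀ + (c j * R) • y)‖ ^ 2) atTop
      (𝓝 (‖W t y‖ ^ 2)) := ((hpt t ht y).norm).pow 2
  have f1 : ∀ᶠ j in atTop, κ' * (-t)⁻¹ < ‖(c j * α) • u (T + c j ^ 2 * β * t) (x₀ + (c j * R) • y)‖ ^ 2 :=
    hlim2.eventually_const_lt hWfast
  filter_upwards [f1] with j hj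
  have hcαj : 0 < c j * α := mul_pos (hcpos _) hα
  have htj : T + c j ^ 2 * β * t < T := by
    have hprod : 0 < c j ^ 2 * β * -t := mul_pos (mul_pos (pow_pos (hcpos j) 2) hβ) ht'
    linarith
  have hkey : critLevel T ν κ' (T + c j ^ 2 * β * t) ^ 2 * (c j * α) ^ 2 = κ' * (-t)⁻¹ := by
    rw [critLevel_sq hκ' hν.le htj, show T - (T + c j ^ 2 * β * t) = c j ^ 2 * β * -t by ring, ← hαν2]
    have hc : c j ≠ 0 := (hcpos j).ne'
    have hα' : α ≠ 0 := hα.ne'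
    have hν' : ν ≠ 0 := hν.ne'
    have ht'' : -t ≠ 0 := ht'.ne'
    field_simp
  rw [norm_smul, mul_pow, Real.norm_eq_abs, abs_of_pos hcαj, ← hkey, mul_comm] at hj
  have hsq : critLevel T ν κ' (T + c j ^ 2 * β * t) ^ 2 <
      ‖u (T + c j ^ 2 * β * t) (x₀ + (c j * R) • y)‖ ^ 2 :=
    lt_of_mul_lt_mul_left hj (pow_pos hcαj 2).le
  exact lt_of_pow_lt_pow_left₀ 2 (norm_nonneg _) hsq

/-- **THE CRITICAL-LEVEL TRANSFER.**  Same frame and proof as `integral_transfer₆τ`, with the subcritical level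
replaced by the critical one `Λ♯ = critLevel T ν κ′` (`0 ≤ κ′`): a finite one-sided top integral forces
`Rd(−s; jet W) ≤ 0` at every point of the OPEN limit fast set `{κ′ < (−s)‖W(s, y)‖²}`. -/
theorem integral_transfer₆τ_crit {T ν M t₀ : ℝ} {u : ℝ → E3 → E3} {p : ℝ → E3 → ℝ} {x₀ : E3} {α β R : ℝ}
    {c : ℕ → ℝ} {W : ℝ → E3 → E3} (hν : 0 < ν)
    (hsol : IsClassicalNSSolutionOn (Ico 0 T) ν 0 u p) (hW : IsTypeIAncientMild M W)
    (ht₀ : 0 ≤ t₀) (ht₀T : t₀ < T)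
    (hα : 0 < α) (hβ : 0 < β) (hαR : α * R = β) (hαν : α * Real.sqrt ν = Real.sqrt β)
    (hcpos : ∀ j, 0 < c j) (hclim : Tendsto c atTop (𝓝 0))
    (hpt : ∀ t < 0, ∀ y : E3,
      Tendsto (fun j => (c j * α) • u (T + c j ^ 2 * β * t) (x₀ + (c j * R) • y)) atTop (𝓝 (W t y)))
    (hgrad : ∀ t < 0, ∀ y : E3,
      Tendsto (fun j => (c j * α * (c j * R)) • fderiv ℝ (u (T + c j ^ 2 * β * t)) (x₀ + (c j * R) • y))
        atTop (𝓝 (fderiv ℝ (W t) y)))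
    (hhess : ∀ t < 0, ∀ y : E3,
      Tendsto (fun j => (c j * α * (c j * R) * (c j * R)) •
          fderiv ℝ (fderiv ℝ (u (T + c j ^ 2 * β * t))) (x₀ + (c j * R) • y))
        atTop (𝓝 (fderiv ℝ (fderiv ℝ (W t)) y)))
    (hlap : ∀ t < 0, ∀ y : E3,
      Tendsto (fun j => (c j * α * (c j * R) * (c j * R) * (c j * R)) •
          lapD (u (T + c j ^ 2 * β * t)) (x₀ + (c j * R) • y))
        atTop (𝓝 (lapD (W t) y)))
    {Rd : ℝ → E3 → (E3 →L[ℝ] E3) → Hess → (E3 →L[ℝ] E3) → ℝ}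
    (hRc : ContinuousOn (fun q : ℝ × E3 × (E3 →L[ℝ] E3) × Hess × (E3 →L[ℝ] E3) =>
      Rd q.1 q.2.1 q.2.2.1 q.2.2.2.1 q.2.2.2.2) {q | 0 < q.1})
    (hRh : ∀ a : ℝ, 0 < a → ∀ τ : ℝ, 0 < τ → ∀ v L H K,
      Rd τ (a • v) (a ^ 2 • L) (a ^ 3 • H) (a ^ 4 • K) = a ^ 6 * Rd (a ^ 2 * τ) v L H K)
    {κ' : ℝ} (hκ' : 0 ≤ κ')
    (hfin : ∫⁻ z, topIntegrandτ T ν t₀ (critLevel T ν κ') Rd u z < ⊤) :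
    ∀ s < 0, ∀ y, κ' < -s * ‖W s y‖ ^ 2 →
      Rd (-s) (W s y) (fderiv ℝ (W s) y) (fderiv ℝ (fderiv ℝ (W s)) y) (lapD (W s) y) ≤ 0 := by
  intro s₀ hs₀ y₀ hne
  have hΛm : Measurable (critLevel T ν κ') := measurable_critLevel T ν κ'
  set Λ : ℝ → ℝ := critLevel T ν κ' with hΛdef
  by_contra hcon
  rw [not_le] at hcon
  set F := topIntegrandτ T ν t₀ Λ Rd u with hF
  have hRd5c : ∀ q : ℝ × E3 × (E3 →L[ℝ] E3) × Hess × (E3 →L[ℝ] E3), 0 < q.1 →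
      ContinuousAt (fun q : ℝ × E3 × (E3 →L[ℝ] E3) × Hess × (E3 →L[ℝ] E3) =>
        Rd q.1 q.2.1 q.2.2.1 q.2.2.2.1 q.2.2.2.2) q :=
    fun q hq => hRc.continuousAt (isOpen_posLag.mem_nhds hq)
  -- the limit read-out as a space–time function
  obtain ⟨QW, hQW⟩ : ∃ QW : ℝ × E3 → E3 × (E3 →L[ℝ] E3) × Hess × (E3 →L[ℝ] E3), ∀ z,
      QW z = (W z.1 z.2, fderiv ℝ (W z.1) z.2, fderiv ℝ (fderiv ℝ (W z.1)) z.2, lapD (W z.1) z.2) :=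
    ⟨_, fun _ => rfl⟩
  obtain ⟨RdW, hRdW⟩ : ∃ RdW : ℝ × E3 → ℝ, ∀ z,
      RdW z = Rd (-z.1) (QW z).1 (QW z).2.1 (QW z).2.2.1 (QW z).2.2.2 := ⟨_, fun _ => rfl⟩
  have hRdW0 : 0 < RdW (s₀, y₀) := by rw [hRdW, hQW]; exact hcon
  -- ### (A) a box `K` around `(s₀, y₀)` on which `RdW > δ`, `W ≠ 0`, `t < s₀ / 2 < 0`
  obtain ⟨q, hcl⟩ := hW.exists_isClassicalNSSolutionOn_Ioo (t₀ := s₀ - 1) (by linarith)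
  have hslab : Ioo (s₀ - 1) 0 ×ˢ (univ : Set E3) ∈ 𝓝 (s₀, y₀) :=
    (isOpen_Ioo.prod isOpen_univ).mem_nhds ⟨⟨by linarith, hs₀⟩, mem_univ _⟩
  have hQc : ContinuousAt QW (s₀, y₀) := by
    have h := (IntegratedStretch.continuousOn_quad (uniqueDiffOn_Ioo (s₀ - 1) 0) hcl.smooth_velocity).continuousAt hslab
    refine (continuousAt_congr (Eventually.of_forall fun z => hQW z)).2 h
  have hpair : ContinuousAt (fun z : ℝ × E3 => ((-z.1 : ℝ), QW z)) (s₀, y₀) :=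
    continuous_fst.neg.continuousAt.prodMk hQc
  have hRdc : ContinuousAt RdW (s₀, y₀) := by
    have h1 := hRd5c ((fun z : ℝ × E3 => ((-z.1 : ℝ), QW z)) (s₀, y₀)) (by show 0 < -s₀; linarith)
    have h := ContinuousAt.comp (f := fun z : ℝ × E3 => ((-z.1 : ℝ), QW z)) (x := (s₀, y₀)) h1 hpair
    exact (continuousAt_congr (Eventually.of_forall fun z => hRdW z)).2 h
  have hWc : ContinuousAt (uncurry W) (s₀, y₀) := hcl.smooth_velocity.continuousOn.continuousAt hslab
  set δ : ℝ := RdW (s₀, y₀) / 2 with hδ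
  have hδpos : 0 < δ := by positivity
  have ev1 : ∀ᶠ z in 𝓝 (s₀, y₀), δ < RdW z :=
    hRdc.eventually (lt_mem_nhds (show δ < RdW (s₀, y₀) by linarith))
  have ev2 : ∀ᶠ z in 𝓝 (s₀, y₀), κ' < -z.1 * ‖uncurry W z‖ ^ 2 :=
    (continuous_fst.neg.continuousAt.mul (hWc.norm.pow 2)).eventually (lt_mem_nhds hne)
  have ev3 : ∀ᶠ z : ℝ × E3 in 𝓝 (s₀, y₀), z.1 < s₀ / 2 :=
    (continuous_fst.tendsto (s₀, y₀)).eventually (gt_mem_nhds (show s₀ < s₀ / 2 by linarith))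
  obtain ⟨r, hr, hball⟩ := Metric.eventually_nhds_iff_ball.1 (ev1.and (ev2.and ev3))
  set ρ : ℝ := r / 2 with hρ
  have hρpos : 0 < ρ := by positivity
  set K : Set (ℝ × E3) := Icc (s₀ - ρ) (s₀ + ρ) ×ˢ closedBall y₀ ρ with hK
  have hKball : K ⊆ ball (s₀, y₀) r := by
    intro z hz
    rw [mem_ball, Prod.dist_eq, max_lt_iff]
    refine ⟨?_, lt_of_le_of_lt (mem_closedBall.1 hz.2) (by linarith)⟩
    rw [Real.dist_eq, abs_lt]
    constructor <;> linarith [hz.1.1, hz.1.2]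
  have hKprop : ∀ z ∈ K, δ < RdW z ∧ κ' < -z.1 * ‖uncurry W z‖ ^ 2 ∧ z.1 < s₀ / 2 :=
    fun z hz => hball z (hKball hz)
  have hKm : MeasurableSet K := measurableSet_Icc.prod isClosed_closedBall.measurableSet
  have hKvol : volume K = ENNReal.ofReal (s₀ + ρ - (s₀ - ρ)) * volume (closedBall y₀ ρ) := by
    rw [hK, Measure.volume_eq_prod ℝ E3, Measure.prod_prod, Real.volume_Icc]
  have hKpos : volume K ≠ 0 := by
    rw [hKvol]
    exact (ENNReal.mul_pos (ENNReal.ofReal_pos.2 (by linarith)).ne'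
      (measure_closedBall_pos volume y₀ hρpos).ne').ne'
  have hKtop : volume K ≠ ⊤ := by
    rw [hKvol]
    exact ENNReal.mul_ne_top ENNReal.ofReal_ne_top measure_closedBall_lt_top.ne
  -- ### (B) the zoom charts `Φ_j`; `ν ∫_{Φ_j K} F = ∫_K (c_j R)⁵ F∘Φ_j → 0`
  have hR := FrozenTop.radius_eq hν hα hβ hαR hαν
  have hRpos : 0 < R := by rw [hR]; positivity
  have ha : ∀ j, 0 < c j ^ 2 * β := fun j => mul_pos (pow_pos (hcpos j) 2) hβ
  have hb : ∀ j, 0 < c j * R := fun j => mul_pos (hcpos j) hRpos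
  obtain ⟨Φ, hΦ⟩ : ∃ Φ : ℕ → ℝ × E3 ≃ᵐ ℝ × E3,
      ∀ j, Φ j = zoomChart T (c j ^ 2 * β) x₀ (c j * R) (ha j).ne' (hb j).ne' := ⟨_, fun _ => rfl⟩
  have hΦapply : ∀ j (z : ℝ × E3), Φ j z = (T + c j ^ 2 * β * z.1, x₀ + (c j * R) • z.2) := by
    intro j z; rw [hΦ j]; rfl
  have hvolK : Tendsto (fun j => volume (Φ j '' K)) atTop (𝓝 0) := by
    have h1 : ∀ j, volume (Φ j '' K) = ENNReal.ofReal (c j ^ 2 * β * (c j * R) ^ 3) * volume K := by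
      intro j; rw [hΦ j]; exact volume_image_zoomChart (ha j) (hb j) K
    simp_rw [h1]
    have h2 : Tendsto (fun j => c j ^ 2 * β * (c j * R) ^ 3) atTop (𝓝 0) := by
      have := ((hclim.pow 2).mul_const β).mul ((hclim.mul_const R).pow 3)
      simpa using this
    have h3 := (ENNReal.continuous_ofReal.tendsto 0).comp h2
    rw [ENNReal.ofReal_zero] at h3
    have h4 := ENNReal.Tendsto.mul_const h3 (Or.inr hKtop)
    rwa [zero_mul] at h4
  have hIK : Tendsto (fun j => ∫⁻ z in Φ j '' K, F z) atTop (𝓝 0) :=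
    tendsto_setLIntegral_zero hfin.ne hvolK
  have hgK : ∀ j, ∫⁻ z in K, ENNReal.ofReal ((c j * R) ^ 5) * F (Φ j z) =
      ENNReal.ofReal ν * ∫⁻ z in Φ j '' K, F z := by
    intro j
    rw [lintegral_const_mul' _ _ ENNReal.ofReal_ne_top, hΦ j,
      setLIntegral_comp_zoomChart (ha j) (hb j) F K, ← mul_assoc,
      ← ENNReal.ofReal_mul (pow_nonneg (hb j).le 5)]
    congr 2
    have hβ' : β = ν * α ^ 2 := by rw [← hαR, hR]; ring
    have hcj : c j ≠ 0 := (hcpos j).ne'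
    rw [hR, hβ']
    field_simp
  have hgK0 : Tendsto (fun j => ∫⁻ z in K, ENNReal.ofReal ((c j * R) ^ 5) * F (Φ j z)) atTop (𝓝 0) := by
    simp_rw [hgK]
    have h := ENNReal.Tendsto.const_mul hIK (Or.inr ENNReal.ofReal_ne_top) (a := ENNReal.ofReal ν)
    rwa [mul_zero] at h
  -- ### (C) Fatou on `K`
  have hFm : AEMeasurable F volume := aemeasurable_topIntegrandτ hν hsol ht₀ hRc hΛm
  have hgm : ∀ j, AEMeasurable (fun z => ENNReal.ofReal ((c j * R) ^ 5) * F (Φ j z)) (volume.restrict K) := by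
    intro j
    have h := aemeasurable_comp_zoomChart (T := T) (x₀ := x₀) (ha j) (hb j) hFm
    rw [← hΦ j] at h
    exact (h.const_mul _).restrict
  have hfatou : ∫⁻ z in K, liminf (fun j => ENNReal.ofReal ((c j * R) ^ 5) * F (Φ j z)) atTop = 0 := by
    have h := lintegral_liminf_le' (μ := volume.restrict K) (u := atTop) hgm
    rw [hgK0.liminf_eq] at h
    exact le_antisymm h bot_le
  -- ### (D) pointwise on `K`: `liminf_j ≥ κ > 0` (the lag slot is FIXED = `−z.1` along the sequence)
  set κ : ℝ := Real.sqrt (-(s₀ / 2)) * δ with hκ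
  have hκpos : 0 < κ := mul_pos (Real.sqrt_pos.2 (by linarith)) hδpos
  have hlow : ∀ z ∈ K, ENNReal.ofReal κ ≤
      liminf (fun j => ENNReal.ofReal ((c j * R) ^ 5) * F (Φ j z)) atTop := by
    intro z hz
    obtain ⟨hz1, hz2, hz3⟩ := hKprop z hz
    have ht : z.1 < 0 := by linarith
    have hzpos : 0 < -z.1 := neg_pos.2 ht
    have hneW : κ' < -z.1 * ‖W z.1 z.2‖ ^ 2 := hz2
    have hfast := eventually_fast_crit (T := T) (x₀ := x₀) (R := R) hν hα hβ hαν hcpos hpt hκ' ht hneW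
    have hτ := (ColumnarTop.tendsto_physicalTime (T := T) hβ ht hcpos hclim).eventually (Ioo_mem_nhdsLT ht₀T)
    have hj := (hpt z.1 ht z.2).prodMk_nhds ((hgrad z.1 ht z.2).prodMk_nhds
      ((hhess z.1 ht z.2).prodMk_nhds (hlap z.1 ht z.2)))
    have hj5 := (tendsto_const_nhds (x := (-z.1 : ℝ)) (f := (atTop : Filter ℕ))).prodMk_nhds hj
    have hlim := (hRd5c ((-z.1 : ℝ), (W z.1 z.2, fderiv ℝ (W z.1) z.2, fderiv ℝ (fderiv ℝ (W z.1)) z.2,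
      lapD (W z.1) z.2)) hzpos).tendsto.comp hj5
    have hz1' : δ < Rd (-z.1) (W z.1 z.2) (fderiv ℝ (W z.1) z.2) (fderiv ℝ (fderiv ℝ (W z.1)) z.2)
        (lapD (W z.1) z.2) := by
      have h := hz1; rw [hRdW, hQW] at h; exact h
    have hRd := hlim.eventually (lt_mem_nhds hz1')
    refine le_liminf_of_le (h := ?_)
    filter_upwards [hfast, hτ, hRd] with j hj1 hj2 hj3
    have hb' := hb j
    have hmem : Φ j z ∈ {z' : ℝ × E3 | z'.1 ∈ Ico t₀ T ∧ Λ z'.1 < ‖u z'.1 z'.2‖} := by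
      rw [hΦapply]
      exact ⟨Ioo_subset_Ico_self hj2, hj1⟩
    -- the value of the integrand at such `j`
    have e1 : c j * α = (c j * R) * ν⁻¹ := by rw [hR]; field_simp
    have e2 : c j * α * (c j * R) = (c j * R) ^ 2 * ν⁻¹ := by rw [hR]; field_simp
    have e3 : c j * α * (c j * R) * (c j * R) = (c j * R) ^ 3 * ν⁻¹ := by rw [hR]; field_simp
    have e4 : c j * α * (c j * R) * (c j * R) * (c j * R) = (c j * R) ^ 4 * ν⁻¹ := by rw [hR]; field_simp
    have hj3' : δ < Rd (-z.1) ((c j * α) • u (T + c j ^ 2 * β * z.1) (x₀ + (c j * R) • z.2))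
        ((c j * α * (c j * R)) • fderiv ℝ (u (T + c j ^ 2 * β * z.1)) (x₀ + (c j * R) • z.2))
        ((c j * α * (c j * R) * (c j * R)) •
          fderiv ℝ (fderiv ℝ (u (T + c j ^ 2 * β * z.1))) (x₀ + (c j * R) • z.2))
        ((c j * α * (c j * R) * (c j * R) * (c j * R)) •
          lapD (u (T + c j ^ 2 * β * z.1)) (x₀ + (c j * R) • z.2)) := hj3
    rw [e4, e3, e2, e1, mul_smul (c j * R) ν⁻¹, mul_smul ((c j * R) ^ 2) ν⁻¹, mul_smul ((c j * R) ^ 3) ν⁻¹,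
      mul_smul ((c j * R) ^ 4) ν⁻¹, hRh _ hb' _ hzpos] at hj3'
    -- hj3' : δ < (c j * R) ^ 6 * Rd ((c j * R) ^ 2 * -z.1) (ν⁻¹ • u …) (ν⁻¹ • ∇u …) (ν⁻¹ • ∇²u …) (ν⁻¹ • K …)
    rw [hF, topIntegrandτ, indicator_of_mem hmem, hΦapply]
    simp only
    rw [← ENNReal.ofReal_mul (pow_nonneg hb'.le 5), nu_timeLag (T := T) (t := z.1) hν hα hβ hαR hαν c j,
      Real.sqrt_mul (sq_nonneg (c j * R)), Real.sqrt_sq hb'.le]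
    refine ENNReal.ofReal_le_ofReal ?_
    have hsq : Real.sqrt (-(s₀ / 2)) ≤ Real.sqrt (-z.1) := Real.sqrt_le_sqrt (by linarith)
    have h6 : (0 : ℝ) < (c j * R) ^ 6 := pow_pos hb' 6
    set m := Rd ((c j * R) ^ 2 * -z.1) (ν⁻¹ • u (T + c j ^ 2 * β * z.1) (x₀ + (c j * R) • z.2))
        (ν⁻¹ • fderiv ℝ (u (T + c j ^ 2 * β * z.1)) (x₀ + (c j * R) • z.2))
        (ν⁻¹ • fderiv ℝ (fderiv ℝ (u (T + c j ^ 2 * β * z.1))) (x₀ + (c j * R) • z.2))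
        (ν⁻¹ • lapD (u (T + c j ^ 2 * β * z.1)) (x₀ + (c j * R) • z.2)) with hm
    have hm6 : δ < (c j * R) ^ 6 * m := hj3'
    have hmax : δ ≤ (c j * R) ^ 6 * max 0 m :=
      hm6.le.trans (mul_le_mul_of_nonneg_left (le_max_right _ _) h6.le)
    calc κ = Real.sqrt (-(s₀ / 2)) * δ := rfl
      _ ≤ Real.sqrt (-z.1) * δ := mul_le_mul_of_nonneg_right hsq hδpos.le
      _ ≤ Real.sqrt (-z.1) * ((c j * R) ^ 6 * max 0 m) :=
          mul_le_mul_of_nonneg_left hmax (Real.sqrt_nonneg _)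
      _ = (c j * R) ^ 5 * (c j * R * Real.sqrt (-z.1) * max 0 m) := by ring
  -- ### (E) contradiction: `0 = ∫_K liminf ≥ κ · vol K > 0`
  have hge : ∫⁻ _ in K, ENNReal.ofReal κ ≤
      ∫⁻ z in K, liminf (fun j => ENNReal.ofReal ((c j * R) ^ 5) * F (Φ j z)) atTop :=
    setLIntegral_mono' hKm fun z hz => hlow z hz
  rw [setLIntegral_const, hfatou] at hge
  exact (mul_ne_zero (ENNReal.ofReal_pos.2 hκpos).ne' hKpos) (le_antisymm hge bot_le)

end Summit.NavierStokesRegularity.NavierStokesRegularity.Theorems.ScenarioCensus.SharpTop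

end
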